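import Literature.AlgebraicGeometry.Resolution.ImmediateRationalUniformization
import Mathlib.Algebra.Polynomial.Taylor
import Mathlib.Algebra.Polynomial.HasseDeriv
import Mathlib.Algebra.Polynomial.Derivative
import HarnessLib

/-!
# A dense separable element generates a Hensel-root extension (Knaf–Kuhlmann 2009, Thm. 1.5: the algebraic step)

Crux `Valuative.LuAlphaPTorsor` (stmt-ResolutionOfSingularities-0641), line `pfaff-line-log-final-forms`,
reshape v6.5 (lead seat c6), stub D2 `stub_denseHenselRoot`.

Ambient setting of `Literature/…/ValuedFunctionFields.lean`: a valued field `(Ω, V)`, a subfield `L`,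
an element `w ∉ L` with a separable equation over `L` (`P(w) = 0`, `P'(w) ≠ 0`), such that `L(w)` is
DENSE over `L` for `v`. Conclusion (`stub_denseHenselRoot`, PROVED): `L(w) = L(η)` for an `η ∈ V`
which is a HENSEL ROOT over `O_L = V ∩ L` (root of a monic `f` over `V ∩ L` with `v(f'(η)) = 1`) —
the input of KK09 Lemma 3.7 (2) in the tree's form `isSmoothlyUniformizableIn_of_henselRoot`, i.e.
the algebraic step of the proof of KK09 Prop. 3.11 / Thm. 1.5 made explicit. Construction:
Taylor-expand `P` at an `a ∈ L` close to `w`, choose `b ∈ L` with `v(b) = v(w - a)`, put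
`η := b / (w - a)`; then `f := Σᵢ eᵢ X^{N-i}` with `eᵢ = P^{[i]}(a) bⁱ / P(a)` has `e₀ = 1`,
`v(e₁) = 1`, `v(eᵢ) < 1` (`i ≥ 2`) — the term `P'(a)(w - a)` dominates the expansion — and
`f'(η) ≡ -e₁ η^{N-2} (mod 𝔪)` is a unit. Source: H. Knaf, F.-V. Kuhlmann, *Every place admits
local uniformization in a finite extension of the function field*, Adv. Math. 221 (2009) 428–453
= arXiv:math/0702856, Lemma 3.7, Prop. 3.11, Thm. 1.5.
-/

set_option linter.dupNamespace false

noncomputable section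

open Polynomial

namespace Summit.ResolutionOfSingularities.ResolutionOfSingularities.Theorems.PfaffLine

open Literature.AlgebraicGeometry.Resolution

variable {Ω : Type} [Field Ω]

/-- The value of a polynomial with coefficients in a subfield `L` at a point of `L` lies in `L`.
[folklore] -/
theorem eval_mem_subfield_of_coeff_mem (L : Subfield Ω) {f : Polynomial Ω}
    (hf : ∀ k, f.coeff k ∈ L) {a : Ω} (ha : a ∈ L) : f.eval a ∈ L := by
  rw [eval_eq_sum_range]
  exact sum_mem fun k _ => mul_mem (hf k) (pow_mem ha k)

/-- Density gives approximations below finitely many non-zero thresholds at once: if every element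
of `E` is approximable from `L` to within any non-zero value of `E`, then for `x ∈ E` and a finite
non-empty family `T ⊆ E ∖ {0}` there is `a ∈ L` with `v(x - a) < v(u)` for all `u ∈ T`.
[folklore] -/
theorem exists_approx_lt_finset (V : ValuationSubring Ω) (L E : Subfield Ω)
    (hdense : ∀ x ∈ E, ∀ w' ∈ E, w' ≠ 0 → ∃ a ∈ L, V.valuation (x - a) < V.valuation w')
    {x : Ω} (hx : x ∈ E) (T : Finset Ω) (hTE : ∀ u ∈ T, u ∈ E ∧ u ≠ 0) (hT : T.Nonempty) :
    ∃ a ∈ L, ∀ u ∈ T, V.valuation (x - a) < V.valuation u := by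
  obtain ⟨u₀, hu₀, hmin⟩ := T.exists_min_image (fun u => V.valuation u) hT
  obtain ⟨a, haL, ha⟩ := hdense x hx u₀ (hTE u₀ hu₀).1 (hTE u₀ hu₀).2
  exact ⟨a, haL, fun u hu => lt_of_lt_of_le ha (hmin u hu)⟩

/-- **Stub D2 `stub_denseHenselRoot` (reshape v6.5), PROVED — density + separability ⇒ a
Hensel-root generator.** If `w ∉ L` satisfies a separable equation over `L` and `L(w)` is dense
over `L`, then `L(w) = L(η)` for some `η ∈ V` which is a root of a monic polynomial `f` over
`V ∩ L` with `v(f'(η)) = 1`. [cite: KnafKuhlmann2009, Lemma 3.7 and Prop. 3.11 (proof)] -/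
theorem stub_denseHenselRoot :
    ∀ (Ω : Type) [Field Ω] (V : ValuationSubring Ω) (L : Subfield Ω) (w : Ω), w ∉ L → (∃ P : Polynomial Ω, (∀ k, P.coeff k ∈ L) ∧ P.eval w = 0 ∧ (Polynomial.derivative P).eval w ≠ 0) → (∀ x ∈ Subfield.closure ((L : Set Ω) ∪ {w}), ∀ w' ∈ Subfield.closure ((L : Set Ω) ∪ {w}), w' ≠ 0 → ∃ a ∈ L, V.valuation (x - a) < V.valuation w') → ∃ η : Ω, η ∈ V ∧ Subfield.closure ((L : Set Ω) ∪ {η}) = Subfield.closure ((L : Set Ω) ∪ {w}) ∧ ∃ f : Polynomial Ω, f.Monic ∧ (∀ k, f.coeff k ∈ V ∧ f.coeff k ∈ L) ∧ f.eval η = 0 ∧ V.valuation ((Polynomial.derivative f).eval η) = 1 := by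
  intro Ω _ V L w hwL hsep hdense
  classical
  obtain ⟨P, hPL, hPw, hP'w⟩ := hsep
  set E : Subfield Ω := Subfield.closure ((L : Set Ω) ∪ {w}) with hE
  have hLE : ∀ x ∈ L, x ∈ E := fun x hx => Subfield.subset_closure (Or.inl hx)
  have hwE : w ∈ E := Subfield.subset_closure (Or.inr rfl)
  have hPE : ∀ k, P.coeff k ∈ E := fun k => hLE _ (hPL k)
  -- the degree `N = M + 2 ≥ 2`
  have hN2 : 2 ≤ P.natDegree := by
    by_contra hlt
    push Not at hlt
    -- `P = c₁ X + c₀` with `c₁ = P'(w) ≠ 0`, so `w = -c₀/c₁ ∈ L`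
    have hP1 : P.natDegree ≤ 1 := Nat.lt_succ_iff.mp hlt
    obtain hlin := Polynomial.eq_X_add_C_of_natDegree_le_one hP1
    have hder : derivative P = C (P.coeff 1) := by
      conv_lhs => rw [hlin]
      simp
    have hc1 : P.coeff 1 = (derivative P).eval w := by
      rw [hder, eval_C]
    have hc1ne : P.coeff 1 ≠ 0 := by rw [hc1]; exact hP'w
    have hw : w = -(P.coeff 0) / P.coeff 1 := by
      have h1 : P.coeff 1 * w + P.coeff 0 = 0 := by
        have := hPw
        rw [hlin] at this
        simpa using this
      field_simp
      linear_combination h1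
    exact hwL (hw ▸ div_mem (neg_mem (hPL 0)) (hPL 1))
  obtain ⟨M, hM⟩ : ∃ M, P.natDegree = M + 2 := ⟨P.natDegree - 2, by omega⟩
  -- notation
  set v := V.valuation with hv
  set dPw : Ω := (derivative P).eval w with hdPw
  set α₁ := v dPw with hα₁
  have hα₁0 : α₁ ≠ 0 := by rw [hα₁]; exact (Valuation.ne_zero_iff v).mpr hP'w
  have hα₁pos : 0 < α₁ := zero_lt_iff.mpr hα₁0
  -- Hasse derivatives and their Taylor coefficients at `w`
  set Q : ℕ → Polynomial Ω := fun i => hasseDeriv i P with hQ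
  have hQL : ∀ i k, (Q i).coeff k ∈ L := fun i k => coeff_hasseDeriv_mem L hPL i k
  have hQE : ∀ i k, (Q i).coeff k ∈ E := fun i k => hLE _ (hQL i k)
  have hQdeg : ∀ i, (Q i).natDegree < M + 3 := fun i =>
    lt_of_le_of_lt (natDegree_hasseDeriv_le P i) (by omega)
  set c : ℕ → ℕ → Ω := fun i j => (taylor w (Q i)).coeff j with hc
  have hcE : ∀ i j, c i j ∈ E := fun i j => coeff_taylor_mem E (hQE i) hwE j
  have hc10 : c 1 0 = dPw := by
    simp only [hc, hQ, taylor_coeff_zero, hasseDeriv_one', hdPw]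
  -- `Q i (a) = Σ_j c i j (a - w)^j` for every `a`
  have hQexp : ∀ i (a : Ω), (Q i).eval a = ∑ j ∈ Finset.range (M + 3), c i j * (a - w) ^ j := by
    intro i a
    have h1 : (Q i).eval a = (taylor w (Q i)).eval (a - w) := by
      rw [taylor_eval, sub_add_cancel]
    rw [h1, eval_eq_sum_range' (by rw [natDegree_taylor]; exact hQdeg i)]
  -- the thresholds: `1` and `P'(w) / c i j` for `1 ≤ i`, `c i j ≠ 0`
  set I : Finset (ℕ × ℕ) := ((Finset.range (M + 3)) ×ˢ (Finset.range (M + 3))).filter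
    (fun ij => 1 ≤ ij.1 ∧ c ij.1 ij.2 ≠ 0) with hI
  set T : Finset Ω := insert 1 (I.image fun ij => dPw / c ij.1 ij.2) with hT
  have hdPL : ∀ k, (derivative P).coeff k ∈ L := fun k => by
    rw [coeff_derivative]
    exact mul_mem (hPL _) (add_mem (natCast_mem L k) (one_mem L))
  have hdPwE : dPw ∈ E := eval_mem_subfield_of_coeff_mem E (fun k => hLE _ (hdPL k)) hwE
  have hTE : ∀ u ∈ T, u ∈ E ∧ u ≠ 0 := by
    intro u hu
    rw [hT, Finset.mem_insert] at hu
    rcases hu with rfl | hu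
    · exact ⟨E.one_mem, one_ne_zero⟩
    · obtain ⟨ij, hij, rfl⟩ := Finset.mem_image.mp hu
      have hij' := (Finset.mem_filter.mp hij).2
      exact ⟨div_mem hdPwE (hcE _ _), div_ne_zero hP'w hij'.2⟩
  have hTne : T.Nonempty := ⟨1, by rw [hT]; exact Finset.mem_insert_self _ _⟩
  -- choose `a ∈ L` close to `w`: `δ := v(w - a)` below all thresholds
  obtain ⟨a, haL, haT⟩ := exists_approx_lt_finset V L E hdense hwE T hTE hTne
  set δ := v (w - a) with hδ
  have haw : w - a ≠ 0 := fun h => hwL (sub_eq_zero.mp h ▸ haL)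
  have hδ0 : δ ≠ 0 := (Valuation.ne_zero_iff v).mpr haw
  have hδpos : 0 < δ := zero_lt_iff.mpr hδ0
  have hδ1 : δ < 1 := by
    have h := haT 1 (by rw [hT]; exact Finset.mem_insert_self _ _)
    rwa [map_one] at h
  have hδc : ∀ i ∈ Finset.range (M + 3), ∀ j ∈ Finset.range (M + 3), 1 ≤ i → c i j ≠ 0 →
      δ * v (c i j) < α₁ := by
    intro i hi j hj hi1 hcij
    have hmem : (i, j) ∈ I := by
      rw [hI, Finset.mem_filter]
      exact ⟨Finset.mem_product.mpr ⟨hi, hj⟩, hi1, hcij⟩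
    have h := haT (dPw / c i j) (by
      rw [hT]
      exact Finset.mem_insert_of_mem (Finset.mem_image.mpr ⟨(i, j), hmem, rfl⟩))
    rw [map_div₀] at h
    have hcpos : 0 < v (c i j) := zero_lt_iff.mpr ((Valuation.ne_zero_iff v).mpr hcij)
    exact (lt_div_iff₀ hcpos).mp h
  -- choose `b ∈ L` with `v(b) = v(w - a)`
  obtain ⟨b, hbL, hvb⟩ : ∃ b ∈ L, v b = δ := by
    have hwaE : w - a ∈ E := sub_mem hwE (hLE a haL)
    obtain ⟨b, hbL, hb⟩ := hdense (w - a) hwaE (w - a) hwaE haw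
    refine ⟨b, hbL, ?_⟩
    -- `v(b) = v((w - a) - ((w - a) - b)) = v(w - a)`
    have h1 : v ((w - a) - b) < v (w - a) := hb
    have h2 := Valuation.map_sub_eq_of_lt_left v h1
    rw [sub_sub_cancel] at h2
    exact h2
  have hb0 : b ≠ 0 := fun h => hδ0 (by rw [← hvb, h, map_zero])
  have hvaw : v (a - w) = δ := by rw [hδ, ← Valuation.map_neg, neg_sub]
  -- key term estimate: for `1 ≤ i` and `(i, j) ≠ (1, 0)`, `v(c i j (a - w)^j (w - a)^i) < α₁ δ`
  have hterm : ∀ i ∈ Finset.range (M + 3), ∀ j ∈ Finset.range (M + 3), 1 ≤ i → (i, j) ≠ (1, 0) →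
      v (c i j * (a - w) ^ j * (w - a) ^ i) < α₁ * δ := by
    intro i hi j hj hi1 hij
    by_cases hcij : c i j = 0
    · rw [hcij, zero_mul, zero_mul, map_zero]
      exact mul_pos hα₁pos hδpos
    have h1 := hδc i hi j hj hi1 hcij
    have hij2 : 2 ≤ i + j := by
      by_contra hlt
      have : i = 1 ∧ j = 0 := by omega
      exact hij (Prod.ext this.1 this.2)
    rw [map_mul, map_mul, map_pow, map_pow, hvaw, ← hδ]
    calc v (c i j) * δ ^ j * δ ^ i = v (c i j) * δ ^ (i + j) := by
          rw [mul_assoc, ← pow_add, add_comm]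
      _ ≤ v (c i j) * δ ^ 2 := mul_le_mul_right (pow_le_pow_right_of_le_one' hδ1.le hij2) _
      _ = (δ * v (c i j)) * δ := by rw [pow_two, ← mul_assoc, mul_comm (v (c i j)) δ]
      _ < α₁ * δ := mul_lt_mul_of_pos_right h1 hδpos
  -- `Q i (a) (w - a)^i` as a double sum
  have hQprod : ∀ i, (Q i).eval a * (w - a) ^ i =
      ∑ j ∈ Finset.range (M + 3), c i j * (a - w) ^ j * (w - a) ^ i := by
    intro i
    rw [hQexp i a, Finset.sum_mul]
  -- (E1) the dominant term: `v(Q 1 (a) (w - a)) = α₁ δ`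
  have hf0 : v (c 1 0 * (a - w) ^ 0 * (w - a) ^ 1) = α₁ * δ := by
    rw [pow_zero, mul_one, pow_one, map_mul, hc10]
  have hE1 : v ((Q 1).eval a * (w - a) ^ 1) = α₁ * δ := by
    rw [hQprod 1]
    have h0mem : (0 : ℕ) ∈ Finset.range (M + 3) := Finset.mem_range.mpr (by omega)
    rw [Valuation.map_sum_eq_of_lt v h0mem, hf0]
    intro j hj
    have hj' : j ∈ Finset.range (M + 3) := (Finset.mem_sdiff.mp hj).1
    have hj0 : j ≠ 0 := fun h =>
      (Finset.mem_sdiff.mp hj).2 (by rw [h]; exact Finset.mem_singleton_self 0)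
    rw [hf0]
    exact hterm 1 (Finset.mem_range.mpr (by omega)) j hj' le_rfl (fun h => hj0 (Prod.mk.inj h).2)
  -- (E2) the higher terms: `v(Q i (a) (w - a)^i) < α₁ δ` for `2 ≤ i`
  have hE2 : ∀ i ∈ Finset.range (M + 3), 2 ≤ i → v ((Q i).eval a * (w - a) ^ i) < α₁ * δ := by
    intro i hi hi2
    rw [hQprod i]
    refine Valuation.map_sum_lt v (mul_ne_zero hα₁0 hδ0) fun j hj => ?_
    exact hterm i hi j hj (by omega) (fun h => by have := (Prod.mk.inj h).1; omega)
  -- (N2) `v(P(a)) = α₁ δ`, from `0 = P(w) = Σ_i Q i (a) (w - a)^i`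
  have hTaylor : ∑ i ∈ Finset.range (M + 3), (Q i).eval a * (w - a) ^ i = 0 := by
    have h1 : P.eval w = (taylor a P).eval (w - a) := by rw [taylor_eval, sub_add_cancel]
    have h2 : (taylor a P).eval (w - a) =
        ∑ i ∈ Finset.range (M + 3), (taylor a P).coeff i * (w - a) ^ i :=
      eval_eq_sum_range' (by rw [natDegree_taylor]; omega) _
    rw [← hPw, h1, h2]
    refine Finset.sum_congr rfl fun i _ => ?_
    rw [taylor_coeff]
  have hPa : v (P.eval a) = α₁ * δ := by
    -- split off the term `i = 0`
    have hsplit := hTaylor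
    rw [Finset.sum_range_succ'] at hsplit
    -- `hsplit : Σ_{i < M+2} Q (i+1) (a) (w-a)^(i+1) + Q 0 (a) (w-a)^0 = 0`
    have hQ0 : (Q 0).eval a * (w - a) ^ 0 = P.eval a := by
      simp only [hQ, hasseDeriv_zero', pow_zero, mul_one]
    rw [hQ0] at hsplit
    have hPa_eq : P.eval a = -∑ i ∈ Finset.range (M + 2), (Q (i + 1)).eval a * (w - a) ^ (i + 1) := by
      linear_combination hsplit
    rw [hPa_eq, Valuation.map_neg]
    have h0mem : (0 : ℕ) ∈ Finset.range (M + 2) := Finset.mem_range.mpr (by omega)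
    rw [Valuation.map_sum_eq_of_lt v h0mem]
    · exact hE1
    · intro i hi
      have hi' : i ∈ Finset.range (M + 2) := (Finset.mem_sdiff.mp hi).1
      have hi0 : i ≠ 0 := fun h => (Finset.mem_sdiff.mp hi).2 (by rw [h]; exact Finset.mem_singleton_self 0)
      rw [hE1]
      exact hE2 (i + 1) (Finset.mem_range.mpr (by have := Finset.mem_range.mp hi'; omega)) (by omega)
  have hPa0 : P.eval a ≠ 0 := (Valuation.ne_zero_iff v).mp (by rw [hPa]; exact mul_ne_zero hα₁0 hδ0)
  have hPaL : P.eval a ∈ L := eval_mem_subfield_of_coeff_mem L hPL haL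
  -- the Hensel root `η := b / (w - a)`
  set η : Ω := b / (w - a) with hη
  have hη0 : η ≠ 0 := div_ne_zero hb0 haw
  have hvη : v η = 1 := by rw [hη, map_div₀, hvb, hδ, div_self hδ0]
  have hηV : η ∈ V := (V.valuation_le_one_iff η).mp hvη.le
  have hbη : b = η * (w - a) := by rw [hη, div_mul_cancel₀ _ haw]
  have hηE : η ∈ E := div_mem (hLE b hbL) (sub_mem hwE (hLE a haL))
  -- the coefficients `e i := Q i (a) bⁱ / P(a)`
  set e : ℕ → Ω := fun i => (Q i).eval a * b ^ i / P.eval a with he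
  have he0 : e 0 = 1 := by
    simp only [he, hQ, hasseDeriv_zero', pow_zero, mul_one, div_self hPa0]
  have heL : ∀ i, e i ∈ L := fun i =>
    div_mem (mul_mem (eval_mem_subfield_of_coeff_mem L (hQL i) haL) (pow_mem hbL i)) hPaL
  have hve : ∀ i, v (e i) = v ((Q i).eval a * (w - a) ^ i) / (α₁ * δ) := by
    intro i
    simp only [he, map_div₀, map_mul, map_pow, hvb, hPa, hδ]
  have hve1 : v (e 1) = 1 := by rw [hve 1, hE1, div_self (mul_ne_zero hα₁0 hδ0)]
  have hvelt : ∀ i ∈ Finset.range (M + 3), 2 ≤ i → v (e i) < 1 := by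
    intro i hi hi2
    rw [hve i, div_lt_one₀ (mul_pos hα₁pos hδpos)]
    exact hE2 i hi hi2
  have hvele : ∀ i ∈ Finset.range (M + 3), v (e i) ≤ 1 := by
    intro i hi
    rcases Nat.lt_or_ge i 2 with hlt | hge
    · interval_cases i
      · rw [he0, map_one]
      · exact hve1.le
    · exact (hvelt i hi hge).le
  have heV : ∀ i ∈ Finset.range (M + 3), e i ∈ V := fun i hi =>
    (V.valuation_le_one_iff _).mp (hvele i hi)
  -- the polynomial `f := Σ_i e i X^(M+2-i)`
  set f : Polynomial Ω := ∑ i ∈ Finset.range (M + 3), C (e i) * X ^ (M + 2 - i) with hf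
  have hfcoeff : ∀ k, f.coeff k = ∑ i ∈ Finset.range (M + 3), if k = M + 2 - i then e i else 0 := by
    intro k
    rw [hf, finsetSum_coeff]
    refine Finset.sum_congr rfl fun i _ => ?_
    rw [coeff_C_mul_X_pow]
  have hfmem : ∀ k, f.coeff k ∈ V ∧ f.coeff k ∈ L := by
    intro k
    rw [hfcoeff k]
    refine ⟨sum_mem fun i hi => ?_, sum_mem fun i _ => ?_⟩
    · split_ifs
      · exact heV i hi
      · exact V.zero_mem
    · split_ifs
      · exact heL i
      · exact L.zero_mem
  have hfmonic : f.Monic := by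
    refine monic_of_natDegree_le_of_coeff_eq_one (M + 2) ?_ ?_
    · rw [hf]
      refine natDegree_sum_le_of_forall_le _ _ fun i _ => ?_
      exact (natDegree_C_mul_X_pow_le _ _).trans (Nat.sub_le _ _)
    · rw [hfcoeff, Finset.sum_eq_single 0]
      · rw [if_pos (by omega), he0]
      · intro i hi hi0
        rw [if_neg (by have := Finset.mem_range.mp hi; omega)]
      · intro h
        exact absurd (Finset.mem_range.mpr (by omega)) h
  have hfeval : ∀ x : Ω, f.eval x = ∑ i ∈ Finset.range (M + 3), e i * x ^ (M + 2 - i) := by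
    intro x
    rw [hf, eval_finsetSum]
    refine Finset.sum_congr rfl fun i _ => ?_
    rw [eval_mul, eval_C, eval_pow, eval_X]
  -- `f(η) = 0`
  have hfη : f.eval η = 0 := by
    rw [hfeval]
    have hterm' : ∀ i ∈ Finset.range (M + 3),
        e i * η ^ (M + 2 - i) = (Q i).eval a * (w - a) ^ i * (η ^ (M + 2) / P.eval a) := by
      intro i hi
      have hi' : i ≤ M + 2 := by have := Finset.mem_range.mp hi; omega
      have hpow : b ^ i * η ^ (M + 2 - i) = η ^ (M + 2) * (w - a) ^ i := by
        rw [hbη, mul_pow, mul_assoc, mul_comm ((w - a) ^ i), ← mul_assoc, pow_mul_pow_sub η hi']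
      simp only [he]
      rw [div_mul_eq_mul_div, mul_assoc, hpow]
      ring
    rw [Finset.sum_congr rfl hterm', ← Finset.sum_mul, hTaylor, zero_mul]
  -- `v(η + e 1) < 1`, from `f(η) = 0`: `η^(M+1) (η + e 1) = -Σ_{i ≥ 2} e i η^(M+2-i)`
  have hηe1 : v (η + e 1) < 1 := by
    have hsum := hfη
    rw [hfeval, Finset.sum_range_succ', Finset.sum_range_succ', he0, one_mul] at hsum
    -- hsum : Σ_{i<M+1} e (i+2) η^(M+2-(i+2)) + e 1 η^(M+2-1) + η^(M+2-0) = 0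
    have hid : η ^ (M + 1) * (η + e 1) =
        -∑ i ∈ Finset.range (M + 1), e (i + 1 + 1) * η ^ (M + 2 - (i + 1 + 1)) := by
      have h1 : η ^ (M + 2 - (0 + 1)) = η ^ (M + 1) := by norm_num
      have h2 : η ^ (M + 2 - 0) = η ^ (M + 1) * η := by rw [Nat.sub_zero, pow_succ]
      rw [h1, h2] at hsum
      linear_combination hsum
    have hlt : v (η ^ (M + 1) * (η + e 1)) < 1 := by
      rw [hid, Valuation.map_neg]
      refine Valuation.map_sum_lt v one_ne_zero fun i hi => ?_
      have hi2 : i + 1 + 1 ∈ Finset.range (M + 3) :=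
        Finset.mem_range.mpr (by have := Finset.mem_range.mp hi; omega)
      rw [map_mul, map_pow, hvη, one_pow, mul_one]
      exact hvelt _ hi2 (by omega)
    rwa [map_mul, map_pow, hvη, one_pow, one_mul] at hlt
  -- the derivative: `f'(η) ≡ -e 1 η^M (mod 𝔪)`
  have hfder : V.valuation ((derivative f).eval η) = 1 := by
    have hD : (derivative f).eval η =
        ∑ i ∈ Finset.range (M + 3), e i * ((M + 2 - i : ℕ) : Ω) * η ^ (M + 2 - i - 1) := by
      rw [hf, derivative_sum, eval_finsetSum]
      refine Finset.sum_congr rfl fun i _ => ?_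
      rw [derivative_C_mul_X_pow, eval_mul, eval_C, eval_pow, eval_X]
    rw [← hv, hD, Finset.sum_range_succ', Finset.sum_range_succ', he0, one_mul]
    -- name the tail
    set S₂ : Ω := ∑ i ∈ Finset.range (M + 1),
      e (i + 1 + 1) * ((M + 2 - (i + 1 + 1) : ℕ) : Ω) * η ^ (M + 2 - (i + 1 + 1) - 1) with hS₂
    have hS₂lt : v S₂ < 1 := by
      refine Valuation.map_sum_lt v one_ne_zero fun i hi => ?_
      have hi2 : i + 1 + 1 ∈ Finset.range (M + 3) :=
        Finset.mem_range.mpr (by have := Finset.mem_range.mp hi; omega)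
      rw [map_mul, map_mul, map_pow, hvη, one_pow, mul_one]
      calc v (e (i + 1 + 1)) * v (((M + 2 - (i + 1 + 1) : ℕ) : Ω))
          ≤ v (e (i + 1 + 1)) * 1 :=
            mul_le_mul_right ((V.valuation_le_one_iff _).mpr (natCast_mem V _)) _
        _ < 1 := by rw [mul_one]; exact hvelt _ hi2 (by omega)
    -- the two head terms plus `e 1 η^M` combine to `(M+2) η^M (η + e 1)`
    have hhead : e 1 * ((M + 2 - (0 + 1) : ℕ) : Ω) * η ^ (M + 2 - (0 + 1) - 1) +
        ((M + 2 - 0 : ℕ) : Ω) * η ^ (M + 2 - 0 - 1) + e 1 * η ^ M =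
        ((M + 2 : ℕ) : Ω) * η ^ M * (η + e 1) := by
      have h1 : (M + 2 - (0 + 1) : ℕ) = M + 1 := by omega
      have h2 : (M + 2 - (0 + 1) - 1 : ℕ) = M := by omega
      have h3 : (M + 2 - 0 : ℕ) = M + 2 := by omega
      have h4 : (M + 2 - 0 - 1 : ℕ) = M + 1 := by omega
      rw [h2, h1, h4, h3]
      push_cast
      ring
    have hheadlt : v (((M + 2 : ℕ) : Ω) * η ^ M * (η + e 1)) < 1 := by
      rw [map_mul, map_mul, map_pow, hvη, one_pow, mul_one]
      calc v (((M + 2 : ℕ) : Ω)) * v (η + e 1) ≤ 1 * v (η + e 1) :=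
            mul_le_mul_left ((V.valuation_le_one_iff _).mpr (natCast_mem V _)) _
        _ < 1 := by rw [one_mul]; exact hηe1
    have hkey : v (S₂ + e 1 * ((M + 2 - (0 + 1) : ℕ) : Ω) * η ^ (M + 2 - (0 + 1) - 1) +
        ((M + 2 - 0 : ℕ) : Ω) * η ^ (M + 2 - 0 - 1) + e 1 * η ^ M) < 1 := by
      rw [add_assoc, add_assoc, ← add_assoc (e 1 * _ * _), hhead]
      exact Valuation.map_add_lt v hS₂lt hheadlt
    have hve1M : v (e 1 * η ^ M) = 1 := by rw [map_mul, map_pow, hve1, hvη, one_pow, one_mul]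
    -- `D = (D + e 1 η^M) - e 1 η^M`
    have hsub : S₂ + e 1 * ((M + 2 - (0 + 1) : ℕ) : Ω) * η ^ (M + 2 - (0 + 1) - 1) +
        ((M + 2 - 0 : ℕ) : Ω) * η ^ (M + 2 - 0 - 1) =
        (S₂ + e 1 * ((M + 2 - (0 + 1) : ℕ) : Ω) * η ^ (M + 2 - (0 + 1) - 1) +
        ((M + 2 - 0 : ℕ) : Ω) * η ^ (M + 2 - 0 - 1) + e 1 * η ^ M) - e 1 * η ^ M := by ring
    rw [hsub, Valuation.map_sub_eq_of_lt_right v (by rw [hve1M]; exact hkey), hve1M]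
  -- the field generated: `L(η) = L(w)`
  have hgen : Subfield.closure ((L : Set Ω) ∪ {η}) = E := by
    refine le_antisymm (Subfield.closure_le.mpr ?_) (Subfield.closure_le.mpr ?_)
    · rintro x (hx | hx)
      · exact hLE x hx
      · rw [Set.mem_singleton_iff.mp hx]; exact hηE
    · rintro x (hx | hx)
      · exact Subfield.subset_closure (Or.inl hx)
      · rw [Set.mem_singleton_iff.mp hx]
        have hbdiv : b / η = w - a := by rw [hbη, mul_div_cancel_left₀ _ hη0]
        have hwa : w = a + b / η := by rw [hbdiv]; ring
        rw [hwa]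
        exact add_mem (Subfield.subset_closure (Or.inl haL))
          (div_mem (Subfield.subset_closure (Or.inl hbL)) (Subfield.subset_closure (Or.inr rfl)))
  exact ⟨η, hηV, hgen, f, hfmonic, hfmem, hfη, hfder⟩

end Summit.ResolutionOfSingularities.ResolutionOfSingularities.Theorems.PfaffLine

end
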